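import Summits.CriticalPhenomena.PercolationContinuityZ3.Theorems.PercNearOneGluingNoHeavyLowerTailChampionStability
import Summits.CriticalPhenomena.PercolationContinuityZ3.Theorems.PercNearOneGluingAdditiveGluingEdgeAffine
import HarnessLib

/-!
# `NoHeavyLowerTail` (stmt-CriticalPhenomena-4575) — the GLUE BRIDGE: raising a pair to weight one = closing the reachability relation
# through the pair, for every reachability functional and EVERY weight of the pair

Support file (prover `prim-hp-3`, hull-port line; `--supports stmt-CriticalPhenomena-4575`).  No definitions, no named facts, no sorries.
Bookkeeping lemma (ii) of the Lean roadmap for the overtaking bound of the two-sided kernel (crux notes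
run/shared/lean/prim/prim-hp-3/PROOF-OVERTAKING-BOUND.md §4; lemma (i) is `…CILReachFunctionalExpansion`): the star expansions produce
events of the form `Φ(Reach^B_ω)` ("lightness with the block `B` glued", written as a disjunction), while the cell inequalities
(`HullPort.lightness_margin_glue_ge_max`, `HullPort.lightness_drop_le_of_glue`) speak about `prodBernoulli (w[e ↦ 1])`.  The bridge:

**Theorem (`Hyperedge.real_update_one_reachFunctional`).**  For every weight `w`, every pair `e = s(r,s)` with `r ≠ s` and every functional
`Φ` of the reachability relation,
`μ_{w[e ↦ 1]}{ω | Φ(Reach_ω)} = μ_w{ω | Φ(Reach^{rs}_ω)}`,  `Reach^{rs}_ω(a,b) :⟺ Reach_ω(a,b) ∨ (a ~_ω {r,s} ∧ {r,s} ~_ω b)`.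
No hypothesis on `w e`: the closed relation `Reach^{rs}_ω` does not see the state of `e` (`Hyperedge.reachGlue_insert`), so the event on the
right has the same probability under `w[e ↦ t]` for every `t` (`real_update_affine`), and at `t = 1` it is the pull-back of `Φ(Reach)` along
`ω ↦ insert e ω` (`tieLiftOne_real_one_eq`, `ChampionStability.reachable_insert_iff`).

Instances (lightness of a vertex, separated lightness events, …) are obtained by choosing `Φ`; e.g. `Φ R := |{z ∈ A : R x z}| ≤ j` gives
`I_{w[s(r,s) ↦ 1]}(x) = μ_w{ |{z ∈ A : x ↔ z ∨ (x ↔ {r,s} ∧ {r,s} ↔ z)}| ≤ j }`, the disjunction form of `Hyperedge.lightness_star_expansion`.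
-/

noncomputable section

namespace Summit.CriticalPhenomena.PercolationContinuityZ3.Theorems

open MeasureTheory Set Literature.Probability.LatticeModels Literature.Probability.Percolation
open scoped Classical BigOperators

variable {n : ℕ}

namespace Hyperedge

open ChampionStability

/-- The closed relation does not see the pair it closes: `Reach^{rs}_{insert s(r,s) ω} = Reach^{rs}_ω`. [folklore] -/
theorem reachGlue_insert (ω : BondConfig (Fin n)) {r s : Fin n} (hrs : r ≠ s) (a b : Fin n) :
    ((openGraph (insert s(r, s) ω)).Reachable a b ∨
        ((∃ t ∈ ({r, s} : Finset (Fin n)), (openGraph (insert s(r, s) ω)).Reachable a t) ∧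
          ∃ t ∈ ({r, s} : Finset (Fin n)), (openGraph (insert s(r, s) ω)).Reachable t b)) ↔
      ((openGraph ω).Reachable a b ∨
        ((∃ t ∈ ({r, s} : Finset (Fin n)), (openGraph ω).Reachable a t) ∧
          ∃ t ∈ ({r, s} : Finset (Fin n)), (openGraph ω).Reachable t b)) := by
  have hmono : ∀ x y : Fin n, (openGraph ω).Reachable x y → (openGraph (insert s(r, s) ω)).Reachable x y := by
    intro x y h
    refine h.mono ?_
    intro c d hcd
    rw [openGraph_adj] at hcd ⊢
    exact ⟨Set.mem_insert_of_mem _ hcd.1, hcd.2⟩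
  -- `a ~ {r,s}` after the insertion iff before (a member of `{r,s}` reached through the new pair is reached at its near end)
  have hto : ∀ x : Fin n, (∃ t ∈ ({r, s} : Finset (Fin n)), (openGraph (insert s(r, s) ω)).Reachable x t) ↔
      ∃ t ∈ ({r, s} : Finset (Fin n)), (openGraph ω).Reachable x t := by
    intro x
    constructor
    · rintro ⟨t, ht, hxt⟩
      rcases (reachable_insert_iff ω hrs x t).1 hxt with h | ⟨⟨t', ht', hxt'⟩, _⟩
      · exact ⟨t, ht, h⟩
      · exact ⟨t', ht', hxt'⟩
    · rintro ⟨t, ht, hxt⟩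
      exact ⟨t, ht, hmono x t hxt⟩
  have hfrom : ∀ y : Fin n, (∃ t ∈ ({r, s} : Finset (Fin n)), (openGraph (insert s(r, s) ω)).Reachable t y) ↔
      ∃ t ∈ ({r, s} : Finset (Fin n)), (openGraph ω).Reachable t y := by
    intro y
    constructor
    · rintro ⟨t, ht, hty⟩
      rcases (reachable_insert_iff ω hrs t y).1 hty with h | ⟨_, ⟨t', ht', ht'y⟩⟩
      · exact ⟨t, ht, h⟩
      · exact ⟨t', ht', ht'y⟩
    · rintro ⟨t, ht, hty⟩
      exact ⟨t, ht, hmono t y hty⟩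
  rw [hto a, hfrom b, reachable_insert_iff ω hrs a b]
  tauto

/-- **Glue bridge.**  For every weight `w`, pair `s(r,s)` (`r ≠ s`) and functional `Φ` of the reachability relation:
`μ_{w[s(r,s) ↦ 1]}{Φ(Reach_ω)} = μ_w{Φ(Reach^{rs}_ω)}` with `Reach^{rs}_ω(a,b) = Reach_ω(a,b) ∨ (a ~ {r,s} ∧ {r,s} ~ b)`. [folklore] -/
theorem real_update_one_reachFunctional (w : Sym2 (Fin n) → unitInterval) {r s : Fin n} (hrs : r ≠ s)
    (Φ : (Fin n → Fin n → Prop) → Prop) :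
    (prodBernoulli (Function.update w s(r, s) 1)).real {ω : BondConfig (Fin n) | Φ fun a b => (openGraph ω).Reachable a b} =
      (prodBernoulli w).real {ω : BondConfig (Fin n) |
        Φ fun a b => (openGraph ω).Reachable a b ∨
          ((∃ t ∈ ({r, s} : Finset (Fin n)), (openGraph ω).Reachable a t) ∧
            ∃ t ∈ ({r, s} : Finset (Fin n)), (openGraph ω).Reachable t b)} := by
  set e : Sym2 (Fin n) := s(r, s) with he
  set G := {ω : BondConfig (Fin n) | Φ fun a b => (openGraph ω).Reachable a b ∨
    ((∃ t ∈ ({r, s} : Finset (Fin n)), (openGraph ω).Reachable a t) ∧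
      ∃ t ∈ ({r, s} : Finset (Fin n)), (openGraph ω).Reachable t b)} with hG
  -- (1) pull back along `insert e`: the glued measure of `Φ(Reach)` is the `w[e ↦ 0]`-measure of `Φ(Reach^{rs})`
  have hpre : (fun ω : BondConfig (Fin n) => insert e ω) ⁻¹'
      {ω : BondConfig (Fin n) | Φ fun a b => (openGraph ω).Reachable a b} = G := by
    ext ω
    simp only [mem_preimage, mem_setOf_eq, hG]
    have hrel : (fun a b => (openGraph (insert e ω)).Reachable a b) = fun a b => (openGraph ω).Reachable a b ∨
        ((∃ t ∈ ({r, s} : Finset (Fin n)), (openGraph ω).Reachable a t) ∧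
          ∃ t ∈ ({r, s} : Finset (Fin n)), (openGraph ω).Reachable t b) := by
      funext a b
      exact propext (reachable_insert_iff ω hrs a b)
    rw [hrel]
  have h1 : (prodBernoulli (Function.update w e 1)).real
      {ω : BondConfig (Fin n) | Φ fun a b => (openGraph ω).Reachable a b} =
      (prodBernoulli (Function.update w e 0)).real G := by
    rw [tieLiftOne_real_one_eq, hpre]
  -- (2) `G` does not see `e`: its `w[e ↦ 1]`- and `w[e ↦ 0]`-measures agree
  have hGpre : (fun ω : BondConfig (Fin n) => insert e ω) ⁻¹' G = G := by
    ext ω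
    simp only [mem_preimage, mem_setOf_eq, hG]
    have hrel : (fun a b => (openGraph (insert e ω)).Reachable a b ∨
        ((∃ t ∈ ({r, s} : Finset (Fin n)), (openGraph (insert e ω)).Reachable a t) ∧
          ∃ t ∈ ({r, s} : Finset (Fin n)), (openGraph (insert e ω)).Reachable t b)) =
        fun a b => (openGraph ω).Reachable a b ∨
          ((∃ t ∈ ({r, s} : Finset (Fin n)), (openGraph ω).Reachable a t) ∧
            ∃ t ∈ ({r, s} : Finset (Fin n)), (openGraph ω).Reachable t b) := by
      funext a b
      exact propext (reachGlue_insert ω hrs a b)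
    rw [hrel]
  have h10 : (prodBernoulli (Function.update w e 1)).real G = (prodBernoulli (Function.update w e 0)).real G := by
    rw [tieLiftOne_real_one_eq, hGpre]
  -- (3) hence the `w[e ↦ t]`-measure of `G` is constant in `t`; take `t = w e`
  have hwe : ((w e : ℝ)) ∈ Set.Icc (0 : ℝ) 1 := (w e).2
  have haff := real_update_affine w e G hwe
  have hproj : Set.projIcc (0 : ℝ) 1 zero_le_one ((w e : ℝ)) = w e := Set.projIcc_val zero_le_one (w e)
  rw [hproj, Function.update_eq_self, h10, sub_self, mul_zero, add_zero] at haff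
  rw [h1, ← haff]

end Hyperedge

end Summit.CriticalPhenomena.PercolationContinuityZ3.Theorems
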